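import Summits.BirchSwinnertonDyer.Rank1Residual.Additive.CyclotomicTowerSignedSelmerEtaAverage
import Summits.BirchSwinnertonDyer.Rank1Residual.X2.DualRestriction
import HarnessLib

/-!
# The `η`-component `X^ε(E/K_∞)^η` is (dual to) a `Λ`-DIRECT SUMMAND of the full dual `X^ε(E/K_∞)`:
# the full dual datum `TowerSignedSelmerDualData`, the injective `Λ`-linear `X^ε(E/K_∞)^η ↪ X^ε(E/K_∞)`
# dual to the `η`-average, and «no finite `Λ`-submodule» DESCENDS from `X^ε(E/K_∞)` to every
# `X^ε(E/K_∞)^η` (cell `bsd-potss`, seat `bsd-potss-k8q-c5` g0; K8 crux (R2±) `NoFiniteSubmoduleSigned`,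
# items stmt-BirchSwinnertonDyer-19117 / 19222 / 19233 — FILE 2 of 2: the reading flag
# `KO18-eta-summand` of the cell's Kitajima–Otsuki frames DISCHARGED in the kernel)

HONEST FRAMING (cell `bsd-potss`, run/shared/lean/pub/bsd-potss/; FULL-BSD rank ≤ 1 programme,
tranche 1b): INFRASTRUCTURE — ONE hypothesis structure (`TowerSignedSelmerDualData`, field for field
cc-typer-6's `EtaSignedSelmerDualData` with `Sel^ε(E/K_∞)^η ↦ Sel^ε(E/K_∞)`), two transparent
definitions (the restricted conjugation `conjTowerSignedSelmerInfty`, the co-restricted average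
`etaAverageToEta`), ONE construction (`towerSignedSelmerDualData`, existence), and THEOREMS; no named
Literature fact, no `Prop` definition, no `sorry`, axioms standard. NOTHING of Kobayashi's Thm. 2.2 or
of Kitajima–Otsuki's Thm. 1.3 is asserted: the file proves the ALGEBRA by which a statement
"`X^ε(E/K_∞)` has no non-zero finite `Λ`-submodule" (the PRINTED shape, `K_∞ = ℚ(μ_{p^∞})`, the whole
dual) implies the same for every `η`-component `X^ε(E/K_∞)^η` (the shape the cell's consumers read:
x1b's `hKO` in `SignedTwistOddBranchReadings`, ctrl's `hKO` in `QuadraticBranchEvenReadingsOfEta`,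
docstring flag `KO18-eta-summand` "the print is for `X^±(F_∞)` whole, an `η`-part is a direct
summand"). Nothing is booked; no label / mark / count moves.

## Source, verbatim (Kitajima–Otsuki, arXiv:1607.03612 = Tokyo J. Math. 41 (2018); Kobayashi 2003 §4)

Main Thm. 1.3: "… (vi) both `Sel^±(F_∞, E[p^∞])^∨` are `Λ`-torsion. Then both `Sel^±(F_∞, E[p^∞])^∨`
have no nontrivial finite `Λ`-submodule" (`Λ = ℤ_p[[Gal(F_∞/F_0)]]`, `F_0 = F(μ_p)`; the WHOLE dual).
Remark 1.4 (5): "Suppose that `E` is defined over `ℚ` and has supersingular reduction at `p` with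
`a_p = 0`. In this case, one can actually show that `Sel^±(F_∞, E[p^∞])^∨` is `Λ`-torsion. Our main
theorem implies that `Sel^±(F_∞, E[p^∞])^∨` has no nontrivial finite `Λ`-submodule for any finite
abelian field `F_0`." §4: "Let `Γ = Gal(F_∞/F_0)` and `Λ = ℤ_p[[Γ]]`. We fix a topological generator
`γ ∈ Γ`. Then we identify … `ℤ_p[[Γ]]` with … `ℤ_p[[X]]` by identifying `γ` with `1 + X`."
Kobayashi p. 8: "`M^η` is given by `ε_η M`."

## What (data as in FILE 1, plus a model `E` of the completion above `p` and a sign `ε`)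

* §3 `TowerSignedSelmerDualData W κ K₀ E γ ε` — `X^ε(E/K_∞) = Hom(Sel^ε(E/K_∞), ℚ/ℤ)` as a
  `Λ = ℤ_p⟦T⟧`-module, `T ↔ conj_γ − 1`; `conjTowerSignedSelmerInfty` and its local nilpotence
  (`isLocNil_conjTowerSignedSelmerInfty_sub_one`, (P) + (A2) of cc-typer-6's FILE 3); EXISTENCE
  `towerSignedSelmerDualData` (word for word cc-typer-6's `etaSignedSelmerDualData`).
* §4 `etaAverageToEta` (`A_η : Sel^ε(E/K_∞) ↠ Sel^ε(E/K_∞)^η`, onto by FILE 1);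
  **`EtaSignedSelmerDualData.exists_linearMap_injective_of_tower`**: an injective `Λ`-LINEAR
  `π : Dη.X → D.X` with `toDual (π x) = toDual_η x ∘ A_η` (x2's abstract
  `X2.DualRestriction.exists_restrict` along the intertwining map `A_η`; injective because `A_η` is
  onto); **`EtaSignedSelmerDualData.forall_finite_eq_bot_of_tower`**: if `D.X` has no non-zero finite
  `Λ`-submodule then neither has `Dη.X` — NO torsion / finite-generation hypothesis;
  `…_of_finite_torsion`: the same with Kitajima–Otsuki's (vi) and Kobayashi's Thm. 2.2 kept as
  displayed hypotheses on the full datum.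

References: [KitajimaOtsuki2018] Main Thm. 1.3, Remark 1.4 (5), §4 (arXiv:1607.03612 pp. 3–4, 18);
[Kobayashi2003] Def. 2.1 and Thm. 2.2 (p. 5), §4 p. 8; [GreenbergLNM1716] §1 p. 60 (the dual as a
`Λ`-module).
-/

noncomputable section

open scoped Classical

universe u

namespace Summit.BirchSwinnertonDyer.Rank1Residual.Additive

open Literature.NumberTheory.EllipticCurves Literature.NumberTheory.GaloisRepresentations
  Literature.NumberTheory.EllipticCurves.IwasawaAlgebra Literature.NumberTheory.EllipticCurves.IwasawaDual
  Literature.NumberTheory.EllipticCurves.Kobayashi2003 ZpExtension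


/-! ## §3 The full dual `X^ε(E/K_∞)` as a hypothesis structure, and its existence -/

section Dual

variable {K : Type u} [Field K] [NumberField K] {p : ℕ} [Fact p.Prime]

/-- **Pontryagin-dual data for the WHOLE `Sel^ε(E/K_∞)`** (`K_∞ = K₀·K_∞^κ`) — field for field
cc-typer-6's `EtaSignedSelmerDualData` with `Sel^ε(E/K_∞)^η ↦ Sel^ε(E/K_∞)`: the Iwasawa module
`X^ε(E/K_∞) = Hom(Sel^ε(E/K_∞), ℚ_p/ℤ_p)` as an abstract `Λ = ℤ_p⟦T⟧`-module `X` (`T ↔ conj_γ − 1`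
for `γ ∈ Gal(K̄/K₀)` with `κ γ` a generator — `Λ = ℤ_p[[Gal(F_∞/F_0)]]`, "we fix a topological
generator `γ ∈ Γ` … identifying `γ` with `1 + X`", Kitajima–Otsuki §4), with `conj_mem`, `toDual`
bijective, `T`/constants axioms. For `K = ℚ`, `κ` cyclotomic, `K₀ = ℚ(μ_p)`, `E = ℚ_[p]`: the object
"`Sel^±(F_∞, E[p^∞])^∨` as a `Λ`-module" of Kitajima–Otsuki's Main Thm. 1.3 for `F = ℚ` (Kobayashi's
`X^±(E/K_∞)`, Thm. 2.2), `Γ_ℚ`-internally. NOTHING about finite generation, torsion or finite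
submodules is asserted. [cite: KitajimaOtsuki2018, §4 (Λ = ℤ_p[[Γ]], γ ↔ 1 + X) and Main Thm. 1.3 (the object only)]
[cite: Kobayashi2003, Def. 2.1 and Thm. 2.2 (p. 5; the object only)] [cite: GreenbergLNM1716, §1 (p. 60)] -/
structure TowerSignedSelmerDualData (W : WeierstrassCurve K) (κ : ZpExtension K p)
    (K₀ : Type u) [Field K₀] [NumberField K₀] [Algebra K K₀] [(galRange (K := K) K₀).Normal]
    (E : Type u) [Field E] [Algebra K E] (γ : Field.absoluteGaloisGroup K) (ε : ℤˣ) where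
  /-- The underlying type of the Iwasawa module `X^ε(E/K_∞)`. -/
  X : Type u
  /-- `X` is an abelian group. -/
  [addCommGroup : AddCommGroup X]
  /-- `X` is a `Λ = ℤ_p⟦T⟧`-module. -/
  [module : Module (IwasawaAlgebra p) X]
  /-- `Sel^ε(E/K_∞)` is stable under conjugation by `γ` (holds by
  `conjH1_mem_towerSignedSelmerInfty`). -/
  conj_mem : ∀ s ∈ towerSignedSelmerInfty W κ K₀ E ε,
    W.conjH1 p (towerTopSubgroup κ K₀) γ s ∈ towerSignedSelmerInfty W κ K₀ E ε
  /-- The identification of `X` with the character group `Hom(Sel^ε_∞, ℚ/ℤ)`. -/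
  toDual : X →+ (towerSignedSelmerInfty W κ K₀ E ε →+ AddCircle (1 : ℚ))
  /-- `toDual` is a group isomorphism. -/
  bijective : Function.Bijective toDual
  /-- `T` acts as `γ - 1`: `(T·x)(s) = x(conj_γ s) - x(s)`. -/
  toDual_T_smul : ∀ (x : X) (s : towerSignedSelmerInfty W κ K₀ E ε),
    toDual ((PowerSeries.X : IwasawaAlgebra p) • x) s =
      toDual x ⟨W.conjH1 p (towerTopSubgroup κ K₀) γ s, conj_mem s s.2⟩ - toDual x s
  /-- Constants `c ∈ ℤ_p` act on `pᵏ`-torsion classes through `ℤ_p → ℤ/pᵏ`. -/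
  toDual_C_smul : ∀ (c : ℤ_[p]) (x : X) (s : towerSignedSelmerInfty W κ K₀ E ε) (k : ℕ),
    (p ^ k) • s = 0 → toDual (PowerSeries.C c • x) s = (PadicInt.toZModPow k c).val • toDual x s

namespace TowerSignedSelmerDualData

variable {W : WeierstrassCurve K} {κ : ZpExtension K p} {K₀ : Type u} [Field K₀] [NumberField K₀]
  [Algebra K K₀] [(galRange (K := K) K₀).Normal] {E : Type u} [Field E] [Algebra K E]
  {γ : Field.absoluteGaloisGroup K} {ε : ℤˣ}

/-- The dual of a datum is an abelian group (instance on the new type `D.X`).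
[cite: Kobayashi2003, Def. 2.1 and Thm. 2.2 (the object only)] -/
instance instAddCommGroupX (D : TowerSignedSelmerDualData W κ K₀ E γ ε) : AddCommGroup D.X :=
  D.addCommGroup

/-- The dual of a datum is a `Λ`-module (instance on `D.X`).
[cite: Kobayashi2003, Def. 2.1 and Thm. 2.2 (the object only)] -/
instance instModuleX (D : TowerSignedSelmerDualData W κ K₀ E γ ε) : Module (IwasawaAlgebra p) D.X :=
  D.module

/-- The **characteristic ideal** `Char(X^ε(E/K_∞)) ⊆ Λ` (`Module.charIdeal`; the object only).
[cite: Kobayashi2003, Thm. 2.2 (p. 5; the object only)] -/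
def charIdeal (D : TowerSignedSelmerDualData W κ K₀ E γ ε) : Ideal (IwasawaAlgebra p) :=
  Literature.NumberTheory.EllipticCurves.Module.charIdeal (IwasawaAlgebra p) D.X

end TowerSignedSelmerDualData

variable (W : WeierstrassCurve K) (κ : ZpExtension K p) (K₀ : Type u) [Field K₀] [NumberField K₀]
  [Algebra K K₀] (E : Type u) [Field E] [Algebra K E] [(galRange (K := K) K₀).Normal] (ε : ℤˣ)

/-- `conj_γ` restricted to an endomorphism of `Sel^ε(E/K_∞)` (`conjH1_mem_towerSignedSelmerInfty`) —
the action through which `Λ = ℤ_p[[Γ]]` acts on `X^ε(E/K_∞)`. [cite: Kobayashi2003, Def. 2.1 (p. 5)] -/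
def conjTowerSignedSelmerInfty (γ : Field.absoluteGaloisGroup K) :
    AddMonoid.End (towerSignedSelmerInfty W κ K₀ E ε) :=
  ((W.conjH1 p (towerTopSubgroup κ K₀) γ).restrict (towerSignedSelmerInfty W κ K₀ E ε)).codRestrict
    (towerSignedSelmerInfty W κ K₀ E ε)
    fun s ↦ conjH1_mem_towerSignedSelmerInfty W κ K₀ E ε γ s.2

/-- Unfolding `conjTowerSignedSelmerInfty` (definitional). [cite: Kobayashi2003, Def. 2.1 (p. 5)] -/
@[simp]
theorem coe_conjTowerSignedSelmerInfty_apply (γ : Field.absoluteGaloisGroup K)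
    (s : towerSignedSelmerInfty W κ K₀ E ε) :
    ((conjTowerSignedSelmerInfty W κ K₀ E ε γ s : towerSignedSelmerInfty W κ K₀ E ε) :
        W.subgroupH1 p (towerTopSubgroup κ K₀)) = W.conjH1 p (towerTopSubgroup κ K₀) γ s :=
  rfl

/-- Powers of the restriction are restrictions of `conj_{γ^m}`. [cite: Kobayashi2003, Def. 2.1 (p. 5)] -/
theorem coe_conjTowerSignedSelmerInfty_pow_apply (γ : Field.absoluteGaloisGroup K) (m : ℕ)
    (s : towerSignedSelmerInfty W κ K₀ E ε) :
    ((((conjTowerSignedSelmerInfty W κ K₀ E ε γ) ^ m) s : towerSignedSelmerInfty W κ K₀ E ε) :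
        W.subgroupH1 p (towerTopSubgroup κ K₀)) = W.conjH1 p (towerTopSubgroup κ K₀) (γ ^ m) s := by
  induction m generalizing s with
  | zero => rw [pow_zero, pow_zero, AddMonoid.End.one_apply,
      W.conjH1_one_holds p (towerTopSubgroup κ K₀), AddMonoidHom.id_apply]
  | succ m ih =>
    rw [pow_succ, AddMonoid.End.coe_mul, Function.comp_apply, ih,
      coe_conjTowerSignedSelmerInfty_apply, pow_succ, W.conjH1_mul_holds p (towerTopSubgroup κ K₀),
      AddMonoidHom.comp_apply]

/-- **`Sel^ε(E/K_∞)` is `p`-primary and `T = conj_γ − 1` is locally nilpotent on it** for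
`γ ∈ Gal(K̄/K₀)` with `κ γ = 1` and `κ` onto on `Gal(K̄/K₀)` — (P) and (A2) of cc-typer-6's FILE 3,
word for word `isLocNil_conjTowerSignedSelmerInftyEta_sub_one`. [cite: GreenbergLNM1716, §1 (p. 60)] -/
theorem isLocNil_conjTowerSignedSelmerInfty_sub_one
    (hK₀ : ∀ x : Multiplicative ℤ_[p], ∃ g ∈ galRange (K := K) K₀, κ g = x)
    {γ : Field.absoluteGaloisGroup K} (hγ : κ.IsTopGenerator γ) (hγ₀ : γ ∈ galRange (K := K) K₀) :
    IwasawaDual.IsLocNil p (conjTowerSignedSelmerInfty W κ K₀ E ε γ - 1) := by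
  have htor : ∀ s : towerSignedSelmerInfty W κ K₀ E ε, ∃ k : ℕ, p ^ k • s = 0 := fun s ↦ by
    obtain ⟨k, hk⟩ := exists_pow_smul_subgroupH1_towerTop_eq_zero W κ K₀
      (s : W.subgroupH1 p (towerTopSubgroup κ K₀))
    exact ⟨k, Subtype.ext (by rw [AddSubgroupClass.coe_nsmul]; exact hk)⟩
  refine ⟨htor, fun s ↦ ?_⟩
  obtain ⟨a, ha⟩ := exists_conjH1_pow_prime_pow_towerTop_eq W κ K₀ hK₀ hγ hγ₀
    (s : W.subgroupH1 p (towerTopSubgroup κ K₀))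
  obtain ⟨k, hk⟩ := htor s
  have hφ : ((conjTowerSignedSelmerInfty W κ K₀ E ε γ) ^ p ^ a) s = s :=
    Subtype.ext (by rw [coe_conjTowerSignedSelmerInfty_pow_apply]; exact ha)
  exact ⟨k * p ^ a, IwasawaDual.pow_mul_prime_pow_apply_eq_zero (Fact.out : p.Prime) _ a hφ hk⟩

/-- **EXISTENCE of the full datum**: `X^ε(E/K_∞) = Hom(Sel^ε(E/K_∞), ℚ/ℤ)` with the `Λ`-structure
`IsLocNil.module` (`T = γ − 1`) IS a `TowerSignedSelmerDualData W κ K₀ E γ ε` — word for word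
cc-typer-6's `etaSignedSelmerDualData`. So every statement "`∀ D : TowerSignedSelmerDualData …`"
is NON-VACUOUS under (A2)'s hypotheses. [cite: GreenbergLNM1716, §1 (p. 60)]
[cite: Kobayashi2003, Def. 2.1 (p. 5)] -/
def towerSignedSelmerDualData
    (hK₀ : ∀ x : Multiplicative ℤ_[p], ∃ g ∈ galRange (K := K) K₀, κ g = x)
    {γ : Field.absoluteGaloisGroup K} (hγ : κ.IsTopGenerator γ) (hγ₀ : γ ∈ galRange (K := K) K₀) :
    TowerSignedSelmerDualData W κ K₀ E γ ε :=
  { X := towerSignedSelmerInfty W κ K₀ E ε →+ AddCircle (1 : ℚ)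
    module := (isLocNil_conjTowerSignedSelmerInfty_sub_one W κ K₀ E ε hK₀ hγ hγ₀).module
    conj_mem := fun s hs ↦ conjH1_mem_towerSignedSelmerInfty W κ K₀ E ε γ hs
    toDual := AddMonoidHom.id _
    bijective := Function.bijective_id
    toDual_T_smul := fun x s ↦ by
      show (isLocNil_conjTowerSignedSelmerInfty_sub_one W κ K₀ E ε hK₀ hγ hγ₀).smulFun
          PowerSeries.X x s = x _ - x s
      rw [(isLocNil_conjTowerSignedSelmerInfty_sub_one W κ K₀ E ε hK₀ hγ hγ₀).smulFun_X_apply,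
        IwasawaDual.End_sub_apply, AddMonoid.End.one_apply, map_sub]
      rfl
    toDual_C_smul := fun c x s k hk ↦ by
      show (isLocNil_conjTowerSignedSelmerInfty_sub_one W κ K₀ E ε hK₀ hγ hγ₀).smulFun
          (PowerSeries.C c) x s = _
      exact (isLocNil_conjTowerSignedSelmerInfty_sub_one W κ K₀ E ε hK₀ hγ hγ₀).smulFun_C_apply
        c x hk }

/-- Non-vacuity: `TowerSignedSelmerDualData W κ K₀ E γ ε` is inhabited for `γ ∈ Gal(K̄/K₀)` a
topological generator and `κ` onto on `Gal(K̄/K₀)`. [cite: GreenbergLNM1716, §1 (p. 60)] -/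
theorem nonempty_towerSignedSelmerDualData
    (hK₀ : ∀ x : Multiplicative ℤ_[p], ∃ g ∈ galRange (K := K) K₀, κ g = x)
    {γ : Field.absoluteGaloisGroup K} (hγ : κ.IsTopGenerator γ) (hγ₀ : γ ∈ galRange (K := K) K₀) :
    Nonempty (TowerSignedSelmerDualData W κ K₀ E γ ε) :=
  ⟨towerSignedSelmerDualData W κ K₀ E ε hK₀ hγ hγ₀⟩

end Dual

/-! ## §4 «No finite `Λ`-submodule» descends from `X^ε(E/K_∞)` to every `η`-component -/

section Summand

variable {K : Type u} [Field K] [NumberField K] (W : WeierstrassCurve K) {p : ℕ} [Fact p.Prime]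
  (κ : ZpExtension K p) (K₀ : Type u) [Field K₀] [NumberField K₀] [Algebra K K₀]
  (E : Type u) [Field E] [Algebra K E] [(galRange (K := K) K₀).Normal]
  (η : Field.absoluteGaloisGroup K →* ℤˣ) (ε : ℤˣ)

/-- `A_η` as an additive map `Sel^ε(E/K_∞) → Sel^ε(E/K_∞)^η` (co-restriction of `etaAverage`).
[cite: Kobayashi2003, §4 p. 8 (ε_η : M → M^η)] -/
def etaAverageToEta (hηK : ∀ σ ∈ galRange (K := K) K₀, η σ = 1) :
    towerSignedSelmerInfty W κ K₀ E ε →+ towerSignedSelmerInftyEta W κ K₀ E η ε :=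
  ((etaAverage W κ K₀ η).restrict (towerSignedSelmerInfty W κ K₀ E ε)).codRestrict
    (towerSignedSelmerInftyEta W κ K₀ E η ε)
    fun t ↦ etaAverage_mem_towerSignedSelmerInftyEta W κ K₀ η E ε hηK t.2

/-- Unfolding `etaAverageToEta` (definitional). [cite: Kobayashi2003, §4 p. 8] -/
@[simp]
theorem coe_etaAverageToEta_apply (hηK : ∀ σ ∈ galRange (K := K) K₀, η σ = 1)
    (t : towerSignedSelmerInfty W κ K₀ E ε) :
    ((etaAverageToEta W κ K₀ E η ε hηK t : towerSignedSelmerInftyEta W κ K₀ E η ε) :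
        W.subgroupH1 p (towerTopSubgroup κ K₀)) = etaAverage W κ K₀ η t :=
  rfl

/-- `A_η : Sel^ε(E/K_∞) → Sel^ε(E/K_∞)^η` is onto for `p ∤ [Γ_K : Gal(K̄/K₀)]`
(`exists_etaAverage_eq`). [cite: Kobayashi2003, §4 p. 8 (M^η = ε_η M)] -/
theorem etaAverageToEta_surjective (hηK : ∀ σ ∈ galRange (K := K) K₀, η σ = 1)
    (hcop : (galRange (K := K) K₀).index.Coprime p) :
    Function.Surjective (etaAverageToEta W κ K₀ E η ε hηK) := by
  intro s
  obtain ⟨t, ht, hts⟩ := exists_etaAverage_eq W κ K₀ η E ε hcop s.2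
  exact ⟨⟨t, ht⟩, Subtype.ext hts⟩

/-- `A_η` intertwines the two restricted conjugations by `γ` (`conjH1_etaAverage`).
[cite: Kobayashi2003, §4 p. 8] -/
theorem conjTowerSignedSelmerInftyEta_etaAverageToEta (hηK : ∀ σ ∈ galRange (K := K) K₀, η σ = 1)
    (γ : Field.absoluteGaloisGroup K) (t : towerSignedSelmerInfty W κ K₀ E ε) :
    conjTowerSignedSelmerInftyEta W κ K₀ E η ε γ (etaAverageToEta W κ K₀ E η ε hηK t) =
      etaAverageToEta W κ K₀ E η ε hηK (conjTowerSignedSelmerInfty W κ K₀ E ε γ t) :=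
  Subtype.ext (by
    rw [coe_conjTowerSignedSelmerInftyEta_apply, coe_etaAverageToEta_apply,
      coe_etaAverageToEta_apply, coe_conjTowerSignedSelmerInfty_apply]
    exact conjH1_etaAverage W κ K₀ η hηK γ t)

/-- **The `Λ`-linear map `X^ε(E/K_∞)^η → X^ε(E/K_∞)` dual to `A_η`, and its injectivity.** For a
full datum `D` and an `η`-datum `Dη` at the same generator `γ ∈ Gal(K̄/K₀)` (`κ` onto on
`Gal(K̄/K₀)`, `η` trivial there, `p ∤ [Γ_K : Gal(K̄/K₀)]`) there is a `Λ`-LINEAR INJECTION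
`π : Dη.X → D.X` with `toDual (π x) = toDual_η x ∘ A_η` — x2's abstract `DualRestriction.exists_restrict`
(the `Λ`-actions are the canonical ones and the canonical action is natural along the intertwining map
`A_η`), injective because `A_η` is onto. This is "`X^η = ε_η X` is a direct summand of `X`" in the
form the descent needs. [cite: Kobayashi2003, §4 p. 8 (M^η = ε_η M)] [cite: GreenbergLNM1716, §1 (p. 60)] -/
theorem EtaSignedSelmerDualData.exists_linearMap_injective_of_tower
    (hK₀ : ∀ x : Multiplicative ℤ_[p], ∃ g ∈ galRange (K := K) K₀, κ g = x)
    {γ : Field.absoluteGaloisGroup K} (hγ : κ.IsTopGenerator γ) (hγ₀ : γ ∈ galRange (K := K) K₀)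
    (hηK : ∀ σ ∈ galRange (K := K) K₀, η σ = 1) (hcop : (galRange (K := K) K₀).index.Coprime p)
    (D : TowerSignedSelmerDualData W κ K₀ E γ ε) (Dη : EtaSignedSelmerDualData W κ K₀ E η γ ε) :
    ∃ π : Dη.X →ₗ[IwasawaAlgebra p] D.X, Function.Injective π ∧
      ∀ x, D.toDual (π x) = (Dη.toDual x).comp (etaAverageToEta W κ K₀ E η ε hηK) := by
  obtain ⟨π, hπ⟩ := X2.DualRestriction.exists_restrict
    (conjTowerSignedSelmerInftyEta W κ K₀ E η ε γ) (conjTowerSignedSelmerInfty W κ K₀ E ε γ)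
    Dη.toDual D.toDual
    (isLocNil_conjTowerSignedSelmerInftyEta_sub_one W κ K₀ E η ε hK₀ hγ hγ₀)
    (isLocNil_conjTowerSignedSelmerInfty_sub_one W κ K₀ E ε hK₀ hγ hγ₀) D.bijective
    (fun x s ↦ by rw [Dη.toDual_T_smul]; rfl) Dη.toDual_C_smul
    (fun x s ↦ by rw [D.toDual_T_smul]; rfl) D.toDual_C_smul
    (etaAverageToEta W κ K₀ E η ε hηK)
    (conjTowerSignedSelmerInftyEta_etaAverageToEta W κ K₀ E η ε hηK γ)
  refine ⟨π, (injective_iff_map_eq_zero π).mpr fun x hx ↦ ?_, hπ⟩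
  have h0 : (Dη.toDual x).comp (etaAverageToEta W κ K₀ E η ε hηK) = 0 := by
    rw [← hπ, hx, map_zero]
  have hx0 : Dη.toDual x = 0 := by
    ext s
    obtain ⟨t, rfl⟩ := etaAverageToEta_surjective W κ K₀ E η ε hηK hcop s
    rw [← AddMonoidHom.comp_apply, h0, AddMonoidHom.zero_apply, AddMonoidHom.zero_apply]
  exact Dη.bijective.1 (by rw [hx0, map_zero])

/-- **Finite generation and torsion DESCEND from `X^ε(E/K_∞)` to `X^ε(E/K_∞)^η`**: through the
injective `Λ`-linear `π : Dη.X → D.X` (`Λ = ℤ_p⟦T⟧` Noetherian; a submodule of a torsion module is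
torsion). So Kobayashi's Thm. 2.2 in its printed form ("`X^±(E/K_∞)` is a finitely generated torsion
`Λ`-module") gives the `η`-component form "`X^±(E/K_∞)^η` is a torsion `ℤ_p[[Γ]]`-module" (p. 8) that
the cell's `η`-frames (x1b's `h22`) display. NOTHING about Thm. 2.2 is asserted here.
[cite: Kobayashi2003, Thm. 2.2 (p. 5) and §4 p. 8 (X^±(E/K_∞)^η is a torsion ℤ_p[[Γ]]-module)] -/
theorem EtaSignedSelmerDualData.finite_isTorsion_of_tower
    (hK₀ : ∀ x : Multiplicative ℤ_[p], ∃ g ∈ galRange (K := K) K₀, κ g = x)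
    {γ : Field.absoluteGaloisGroup K} (hγ : κ.IsTopGenerator γ) (hγ₀ : γ ∈ galRange (K := K) K₀)
    (hηK : ∀ σ ∈ galRange (K := K) K₀, η σ = 1) (hcop : (galRange (K := K) K₀).index.Coprime p)
    (D : TowerSignedSelmerDualData W κ K₀ E γ ε) (Dη : EtaSignedSelmerDualData W κ K₀ E η γ ε)
    (hD : Module.Finite (IwasawaAlgebra p) D.X ∧ Module.IsTorsion (IwasawaAlgebra p) D.X) :
    Module.Finite (IwasawaAlgebra p) Dη.X ∧ Module.IsTorsion (IwasawaAlgebra p) Dη.X := by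
  obtain ⟨π, hinj, -⟩ := EtaSignedSelmerDualData.exists_linearMap_injective_of_tower W κ K₀ E η ε
    hK₀ hγ hγ₀ hηK hcop D Dη
  haveI := hD.1
  refine ⟨Module.Finite.of_injective π hinj, fun x ↦ ?_⟩
  obtain ⟨a, ha⟩ := @hD.2 (π x)
  exact ⟨a, hinj (by rw [map_zero, LinearMap.map_smul_of_tower, ha])⟩

/-- **«No non-zero finite `Λ`-submodule» DESCENDS from `X^ε(E/K_∞)` to `X^ε(E/K_∞)^η`** — the
reading flag `KO18-eta-summand` of the cell's Kitajima–Otsuki frames, PROVED: for a full datum `D`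
and an `η`-datum `Dη` at the same `γ` (hypotheses as above), if every finite `Λ`-submodule of `D.X` is
`0` then so is every finite `Λ`-submodule of `Dη.X` (its image under the injective `Λ`-linear `π` is a
finite submodule of `D.X`). NO finite-generation / torsion hypothesis is used. Kitajima–Otsuki's
Main Thm. 1.3 / Remark 1.4 (5) is stated for the WHOLE `Sel^±(F_∞, E[p^∞])^∨`; this is the passage to
its `η`-components. NOTHING about the printed theorem is asserted here.
[cite: KitajimaOtsuki2018, Main Thm. 1.3 and Remark 1.4 (5) (arXiv:1607.03612 pp. 3–4)]
[cite: Kobayashi2003, §4 p. 8 (M^η = ε_η M)] -/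
theorem EtaSignedSelmerDualData.forall_finite_eq_bot_of_tower
    (hK₀ : ∀ x : Multiplicative ℤ_[p], ∃ g ∈ galRange (K := K) K₀, κ g = x)
    {γ : Field.absoluteGaloisGroup K} (hγ : κ.IsTopGenerator γ) (hγ₀ : γ ∈ galRange (K := K) K₀)
    (hηK : ∀ σ ∈ galRange (K := K) K₀, η σ = 1) (hcop : (galRange (K := K) K₀).index.Coprime p)
    (D : TowerSignedSelmerDualData W κ K₀ E γ ε) (Dη : EtaSignedSelmerDualData W κ K₀ E η γ ε)
    (hD : ∀ N : Submodule (IwasawaAlgebra p) D.X, Finite N → N = ⊥) :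
    ∀ M : Submodule (IwasawaAlgebra p) Dη.X, Finite M → M = ⊥ := by
  obtain ⟨π, hinj, -⟩ := EtaSignedSelmerDualData.exists_linearMap_injective_of_tower W κ K₀ E η ε
    hK₀ hγ hγ₀ hηK hcop D Dη
  intro M hM
  haveI : Finite (M.map π) := by
    refine Finite.of_surjective (fun m : M ↦ (⟨π m, Submodule.mem_map_of_mem m.2⟩ : M.map π)) ?_
    rintro ⟨y, hy⟩
    obtain ⟨m, hm, rfl⟩ := Submodule.mem_map.mp hy
    exact ⟨⟨m, hm⟩, rfl⟩
  have hbot := hD (M.map π) inferInstance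
  rw [Submodule.eq_bot_iff] at hbot ⊢
  intro x hx
  exact hinj (by rw [map_zero]; exact hbot _ (Submodule.mem_map_of_mem hx))

/-- The same with the displayed hypotheses of the printed theorem kept on BOTH sides: if the full
dual has no non-zero finite `Λ`-submodule WHENEVER it is finitely generated `Λ`-torsion (Kitajima–Otsuki
Main Thm. 1.3 (vi)), and it IS finitely generated `Λ`-torsion (Kobayashi Thm. 2.2 for `X^ε(E/K_∞)` —
a displayed hypothesis `h22`, not asserted), then every `η`-datum has no non-zero finite
`Λ`-submodule. [cite: KitajimaOtsuki2018, Main Thm. 1.3 with (vi)] [cite: Kobayashi2003, Thm. 2.2 (p. 5)] -/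
theorem EtaSignedSelmerDualData.forall_finite_eq_bot_of_tower_of_finite_torsion
    (hK₀ : ∀ x : Multiplicative ℤ_[p], ∃ g ∈ galRange (K := K) K₀, κ g = x)
    {γ : Field.absoluteGaloisGroup K} (hγ : κ.IsTopGenerator γ) (hγ₀ : γ ∈ galRange (K := K) K₀)
    (hηK : ∀ σ ∈ galRange (K := K) K₀, η σ = 1) (hcop : (galRange (K := K) K₀).index.Coprime p)
    (D : TowerSignedSelmerDualData W κ K₀ E γ ε) (Dη : EtaSignedSelmerDualData W κ K₀ E η γ ε)
    (h22 : Module.Finite (IwasawaAlgebra p) D.X ∧ Module.IsTorsion (IwasawaAlgebra p) D.X)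
    (hKO : Module.Finite (IwasawaAlgebra p) D.X → Module.IsTorsion (IwasawaAlgebra p) D.X →
      ∀ N : Submodule (IwasawaAlgebra p) D.X, Finite N → N = ⊥) :
    ∀ M : Submodule (IwasawaAlgebra p) Dη.X, Finite M → M = ⊥ :=
  EtaSignedSelmerDualData.forall_finite_eq_bot_of_tower W κ K₀ E η ε hK₀ hγ hγ₀ hηK hcop D Dη
    (hKO h22.1 h22.2)

end Summand

end Summit.BirchSwinnertonDyer.Rank1Residual.Additive

end
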